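import Summits.ABC.ABC.Theses.DefiniteXi
import Summits.ABC.ABC.Theses.IsogenyGlueCongruence
import Summits.ABC.ABC.Theorems.DefiniteXiPeterssonLowerBound
import Summits.ABC.ABC.Theorems.IsogenyGlueCongruencePeterssonLowerBound
import HarnessLib

/-!
# `PeterssonOfSymmFour` (stmt-ABC-15911): the `Sym⁴` package implies the Petersson lower bound

Wiring item shared by the routes `DefiniteXi` and `IsogenyGlueCongruence`:
`SymmFourAnalyticPackage → PeterssonLowerBound`.

The route decl `SymmFourAnalyticPackage` is verbatim (definitionally) the body of the Literature named fact
`Literature.NumberTheory.Automorphic.Kim2003_symmFourL_nonCM_entire_polyBound` (the analytic package of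
`L^{(N)}(s, Sym⁴ E)` for non-CM `E/ℚ`), and the landed composition
`Summit.ABC.ABC.Theorems.PeterssonLowerBound_of` (`Theorems/DefiniteXiPeterssonLowerBound.lean`:
Goldfeld–Hoffstein–Lieman on the Siegel ball, single automorphic input `Sym⁴`) proves
`DefiniteXi.PeterssonLowerBound` from that fact; `IsogenyGlueCongruence_PeterssonLowerBound_of`
(`Theorems/IsogenyGlueCongruencePeterssonLowerBound.lean`) is its twin for the second route. Both implications
are therefore one `exact`.
-/

set_option linter.dupNamespace false

namespace Summit.ABC.ABC.Theorems

/-- **`DefiniteXi.PeterssonOfSymmFour`** (stmt-ABC-15911): the analytic package of `L(s, Sym⁴ E)` for non-CM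
`E/ℚ` (route crux `SymmFourAnalyticPackage`, same term as the named fact
`Kim2003_symmFourL_nonCM_entire_polyBound`) implies the Petersson lower bound
`c_ε · N^{1−ε} ≤ Re ⟨f,f⟩_{Γ₀(N)}` for the newform of every elliptic curve over `ℚ`
(route decl `PeterssonLowerBound`). Proof: the landed composition `PeterssonLowerBound_of`.
[cite: HoffsteinLockhart1994, Thm. 0.1] [cite: MurtyCongruencePrimes1999, §2] -/
theorem peterssonOfSymmFour_proof : Summit.ABC.ABC.Theses.DefiniteXi.PeterssonOfSymmFour := by
  unfold Summit.ABC.ABC.Theses.DefiniteXi.PeterssonOfSymmFour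
  intro hSym4
  exact PeterssonLowerBound_of hSym4

/-- **`IsogenyGlueCongruence.PeterssonOfSymmFour`** (stmt-ABC-15911, second route, same decl text): the
`Sym⁴` analytic package implies the Petersson lower bound for route `IsogenyGlueCongruence`.
Proof: the landed twin `IsogenyGlueCongruence_PeterssonLowerBound_of`.
[cite: HoffsteinLockhart1994, Thm. 0.1] [cite: MurtyCongruencePrimes1999, §2] -/
theorem isogenyGlueCongruence_peterssonOfSymmFour_proof :
    Summit.ABC.ABC.Theses.IsogenyGlueCongruence.PeterssonOfSymmFour := by
  unfold Summit.ABC.ABC.Theses.IsogenyGlueCongruence.PeterssonOfSymmFour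
  intro hSym4
  exact IsogenyGlueCongruence_PeterssonLowerBound_of hSym4

end Summit.ABC.ABC.Theorems
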